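import Summits.QuantumFields.YangMills.Theorems.BalabanUVNodesPortS1RecordDtHol
import Summits.QuantumFields.YangMills.Theorems.BalabanUVNodesK0RecordFormatNamesFluctInt

/-!
# Port S1, socket (o3)-IV — THE REALITY BRIDGE: `D̃ = recordDt` MAPS REAL COORDINATES TO 𝔰𝔲(2)-VALUED FIELDS, `h_ℂ D̃(↑y)` IS REAL, AND ★★ DEF-1's `recordDtCorrOf`∕`recordReparamOf`
# AT THE `recordDt` FAMILY ARE THE REAL TRANSLATION `y ↦ h D̃(↑y)` ∕ `Φ(g•x)` EXACTLY (their `Re` is exact — ✓`…K0RecordFormatNamesFluctInt` convention (c2))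

Cell `ym-nodeO-ideate`, porter seat PT-A-1 (gen 10); `--kind proof --supports stmt-QuantumFields-27930 --as helper`; count-neutral.  [I] = [Balaban1987RG1]; [15] = [Balaban1985Variational];
[B7] = [Balaban1985Averaging].  Director-ym R702-ym docket (1) (o3): the bridge from the complex change of variables (✓`…PortS1RecordDtHol`, p828685) to ★★ DEF-1's real (o3)-formula
`recordDtJacOf` (✓p828316): lit ✓`B12Lineariz267.Dt_mem_of_mapsTo` («with `S` = the real subspace … `D̃` of a real `B` is real, so `Φ` is a change of REAL variables») AT THE RECORD.

WHAT IS PROVED (`R = 1∕(10⁸dL)`, `C₂ = 2∕R²`; letters (o1-ε) at a quantified radius `ρ`):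
* §1 ★ `window_fiftieth_of_oneStep` — PT-B's one-step re-gauge estimate gives the series-log window `‖M_h(Ṽ)(c)·Ū(Vk)(c)⋆ − 1‖ ≤ 1∕50` (✓`windows_of_oneStep` rounded to `1∕2`; the same
  proof, sharper rounding: `(1+2φ)(1+τ)(1+4φ) − 1 ≤ 1∕50` for `τ ≤ 1∕100`, `φ ≤ 10⁻⁶`), hence ★ `recordQtC_ofReal_mem_lieSU` — `Q̃_ℂ(Vk)(↑x)(c) ∈ 𝔰𝔲(2)` for real `‖x‖ < R` ([B7] (22)–(23):
  the series log of an `SU(2)` matrix within `⅓` of `1` is anti-Hermitian traceless), ★ `recordCtC_ofReal_mem_lieSU` (`C̃_ℂ = Q̃_ℂ − LQ̃_ℂ`, ✓`recordLQtC_ofReal` + ✓`recordLQt_mem_lieSU_of_small`).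
* §2 `norm_ofReal_pi_eq` (`‖↑x‖ = ‖x‖`), `ofReal_pi_sub_hopLinGraphC_of_mem_lieSU` (`↑y − h_ℂ X = ↑(y − hX)` on 𝔰𝔲(2)-valued `X`).
* §3 ★★★ `recordDt_ofReal_mem_lieSU` — for real `y` with `‖↑y‖ < ρ`: `recordDt Vk ρ ↑y c ∈ 𝔰𝔲(2)` for every coarse bond `c` (the contraction restricted to the closed, `T`-stable set of 𝔰𝔲(2)-valued
  fields, lit `Dt_mem_of_mapsTo`); ★★ `hopLinGraphC_recordDt_ofReal` (`h_ℂ D̃(↑y) = ↑(h D̃(↑y))`, ◆ R-k bridge ✓`hopLinGraphC_of_mem_lieSU`).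
* §4 AT ★★ DEF-1's NAMES (✓`…FluctInt` §24q, `Dt := fun Vk => recordDt F k K Vk ρ`): ★★ `recordDtCorrOf_recordDt` (`recordDtCorrOf … Vk y = hopLinGraph Vk (recordDt Vk ρ ↑y)` — NO `Re`-junk),
  ★★ `ofReal_recordReparamOf_recordDt` (`↑(recordReparamOf … Vk g x) = Φ(↑(g•x))`: print's old variable `B′ = B − hD̃(B)` at `B = g_k x` IS the complex translate read on the real slice),
  `norm_ofReal_recordReparamOf_recordDt_lt` (`‖↑Y_g(x)‖ < 2ρ`).

HONEST FRAMING.  Reality bookkeeping over landed estimates; the derivative∕determinant half of the bridge (`fderiv ℝ recordDtCorrOf` = the real restriction of `h_ℂ∘DD̃`, `recordDtJacOf = −log‖det DΨ(↑Y)‖`)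
is the NEXT file; nothing of Bałaban's renormalization-group estimates asserted, ported or discharged beyond this; `stub_FE` (XXL) ∕ `stub_P0C` OPEN, ⟨27930⟩ OPEN (1∕3); NODE O 0∕1; COUNT 8∕28 ·
K 1∕4 UNMOVED; finite `𝕋⁴_{L^K}` at fixed ε — NOT continuum ∕ OS; **the Yang–Mills mass gap (Clay) is NOT proved by any of this.**  No `sorry`, no `def`, no `instance`; standard axioms only.
-/

noncomputable section

open scoped BigOperators Matrix.Norms.L2Operator Topology

open Set Metric Filter

namespace Summit.QuantumFields.YangMills.Theorems.BalabanUVNodesPortS1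

open Summit.QuantumFields.YangMills.Theorems.K0RecordFormatNames
open Literature.MathematicalPhysics.QuantumFieldTheory.Balaban1983to89
open Literature.MathematicalPhysics.QuantumFieldTheory.Balaban1983to89.Node00
open Literature.MathematicalPhysics.QuantumFieldTheory.Balaban1983to89.T4Continuum (T4Family)
open Literature.MathematicalPhysics.QuantumFieldTheory.Balaban1983to89.T4AdjointCovarianceUnitary (lieSU mem_lieSU_iff)
open Literature.MathematicalPhysics.QuantumFieldTheory.Balaban1983to89.B15AveragingHolomorphic (avgMh loopMh coe_avgFun_eq_avgMh)
open Literature.MathematicalPhysics.QuantumFieldTheory.Balaban1983to89.BlockAveraging (Small Idx)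
open Literature.MathematicalPhysics.QuantumFieldTheory.Balaban1983to89.ExpMeanLog (expMeanLogSU)
open Summit.QuantumFields.YangMills.Theorems.C44IterMh (exists_regauge norm_inv_sub_one_le_of_det norm_unitary_conj_sub_one_eq norm_mul_sub_one_le_of_le₂)
open _root_.Matrix

variable (F : T4Family)

/-! ## §1  The `1∕50` series-log window and `Q̃_ℂ`, `C̃_ℂ` of real coordinates are 𝔰𝔲(2)-valued -/

/-- ★ **THE SERIES-LOG WINDOW, SHARP ROUNDING**: in PT-B's one-step currency (as ✓`windows_of_oneStep`, whose (b) rounds to `1∕2`), `‖M_h(Ṽ)(c) · Ū(Vk)(c)⋆ − 1‖ ≤ 1∕50` — re-gauge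
`M_h(Ṽ)(c) = H(c₋)·Ṽ′(c)·H(c₊)⁻¹` with `‖H − 1‖ ≤ 2φ`, `‖Ṽ′(c)·M_h(Vk)(c)⋆ − 1‖ ≤ τ ≤ 1∕100`, so the product is within `(1+2φ)(1+τ)(1+4φ) − 1 ≤ 1∕50` of `1`.
[cite: Balaban1985Averaging, (47) p.25, Proposition 3 p.36; Balaban1987RG1, (0.4) p.253, (2.4) p.266] -/
theorem window_fiftieth_of_oneStep (k K : ℕ) (hk : k + 1 ≤ (F.P K).m + (F.P K).K) (Vk : GaugeField (F.P K) k (SU 2)) (z : FluctIdx F k K → ℂ) {s φ lam ε : ℝ}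
    (hs : ∀ b, ‖pertC F k K Vk z b * star (Vk b : MatA 2) - 1‖ ≤ s) (hφ : (1 + 2 * s) ^ ((F.P K).d * (F.P K).L) - 1 ≤ φ) (hlam : (1 + 2 * s) ^ (F.P K).L - 1 ≤ lam)
    (hε : ∀ (c : PBond (F.P K) (k + 1)) (i : Idx (F.P K)), ‖loopM (coeField Vk) c i - 1‖ ≤ ε) (hκ : φ + lam ≤ 1 / 10 ^ 6) (hε50 : ε ≤ 1 / 50)
    (c : PBond (F.P K) (k + 1)) (hVk : Small expMeanLogSU Vk c) :
    ‖avgMh (pertC F k K Vk z) c * star (((avOfRecord F 2 K k).avg Vk c : SU 2) : MatA 2) - 1‖ ≤ 1 / 50 := by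
  have _ := hk
  have hs0 : 0 ≤ s := (norm_nonneg _).trans (hs (K0RecordFormatNames.recordB0 F k K c))
  have h1s : (1 : ℝ) ≤ 1 + 2 * s := by linarith
  have hφ0 : 0 ≤ φ := le_trans (by linarith [one_le_pow₀ h1s (n := (F.P K).d * (F.P K).L)]) hφ
  have hlam0 : 0 ≤ lam := le_trans (by linarith [one_le_pow₀ h1s (n := (F.P K).L)]) hlam
  have hκ1 : φ + lam ≤ 1 / 1000000 := hκ.trans (by norm_num)
  have hε0 : 0 ≤ ε := (norm_nonneg _).trans (hε c (Classical.arbitrary _))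
  have hN : ((2 : ℕ) : ℝ) * (7 * (φ + lam) + ε) ≤ 3 := by push_cast; linarith
  have hdet : ∀ b, (pertC F k K Vk z b).det = 1 := det_pertC F k K Vk z
  obtain ⟨H, V', hHdet, hH, havg, -, hV'⟩ := exists_regauge Vk hdet hs hφ hlam hε hκ hε50 hN
  set A : MatA 2 := (((avOfRecord F 2 K k).avg Vk c : SU 2) : MatA 2) with hA
  have hAu : A ∈ Matrix.unitaryGroup (Fin 2) ℂ := ((avOfRecord F 2 K k).avg Vk c).2.1
  have hAcoe : avgMh (coeField Vk) c = A := (coe_avgFun_eq_avgMh Vk c hVk).symm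
  have hτ := hV' c
  rw [hAcoe] at hτ
  set τ : ℝ := ((1 + s) ^ (F.P K).L - 1) + 1200000 * (φ + lam) ^ 2 + 13000 * ε * (φ + lam) with hτdef
  have hτ0 : 0 ≤ τ := (norm_nonneg _).trans hτ
  have hτle : τ ≤ 1 / 100 := by
    have h1 : (1 + s) ^ (F.P K).L - 1 ≤ lam := by
      have : (1 + s) ^ (F.P K).L ≤ (1 + 2 * s) ^ (F.P K).L := pow_le_pow_left₀ (by linarith) (by linarith) _
      linarith
    have h2 : (φ + lam) ^ 2 ≤ (φ + lam) * (1 / 1000000) := by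
      rw [sq]; exact mul_le_mul_of_nonneg_left hκ1 (by linarith)
    have h3 : 13000 * ε * (φ + lam) ≤ 13000 * (1 / 50) * (1 / 1000000) := by
      apply mul_le_mul (mul_le_mul_of_nonneg_left hε50 (by norm_num)) hκ1 (by linarith) (by positivity)
    rw [hτdef]; nlinarith
  have hHinv : ‖(H c.tgt)⁻¹ - 1‖ ≤ 2 * (2 * φ) :=
    norm_inv_sub_one_le_of_det (C44IterMh.sl_isUnit_det (hHdet c.tgt)) (hH c.tgt) (by linarith)
  have hconj : ‖A * (H c.tgt)⁻¹ * star A - 1‖ ≤ 4 * φ := by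
    rw [norm_unitary_conj_sub_one_eq hAu]; linarith
  have hV'eq : V' c = (V' c * star A) * A := by
    rw [mul_assoc, (Matrix.mem_unitaryGroup_iff').1 hAu, mul_one]
  have hX : avgMh (pertC F k K Vk z) c * star A = H c.src * (V' c * star A) * (A * (H c.tgt)⁻¹ * star A) := by
    rw [havg c]
    conv_lhs => rw [hV'eq]
    simp only [mul_assoc]
  rw [hX]
  have h12 := norm_mul_sub_one_le_of_le₂ (hH c.src) hτ
  have h123 := norm_mul_sub_one_le_of_le₂ h12 hconj
  refine h123.trans ?_
  have hφ6 : φ ≤ 1 / 1000000 := by linarith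
  nlinarith [mul_nonneg hφ0 hτ0, mul_nonneg hφ0 hφ0, mul_nonneg (mul_nonneg hφ0 hτ0) hφ0, mul_le_mul hφ6 hτle hτ0 (by norm_num),
    mul_le_mul hφ6 hφ6 hφ0 (by norm_num)]

/-- ★ **`Q̃_ℂ(Vk)(↑x)(c) ∈ 𝔰𝔲(2)` FOR REAL `‖x‖ < R`**: on the real slice `Q̃_ℂ = Q̃ = mlog(M(V′V^{(k)})(c)·M(V^{(k)})(c)⁻¹)` with the `SU(2)` quotient within `1∕50 ≤ ⅓` of `1` (§1 at `z = ↑x`,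
the guard at the perturbed field by ✓`small_pert_of_norm_lt`), and the series log of such a matrix is anti-Hermitian traceless. [cite: Balaban1985Averaging, (22)–(23) p.21; Balaban1987RG1, (2.4) p.266, p.267] -/
theorem recordQtC_ofReal_mem_lieSU (k K : ℕ) (hk : k + 1 ≤ (F.P K).m + (F.P K).K) (Vk : GaugeField (F.P K) k (SU 2)) {ε : ℝ}
    (hε : ∀ (c : PBond (F.P K) (k + 1)) (i : Idx (F.P K)), ‖loopM (coeField Vk) c i - 1‖ ≤ ε) (hε50 : ε ≤ 1 / 50)
    (hVk : ∀ c, Small expMeanLogSU Vk c) (x : FluctIdx F k K → ℝ) (hx : ‖x‖ < 1 / (10 ^ 8 * (F.P K).d * (F.P K).L)) (c : PBond (F.P K) (k + 1)) :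
    recordQtC F k K Vk (fun i => (x i : ℂ)) c ∈ lieSU (Fin 2) := by
  have hsmall := small_pert_of_norm_lt F k K hk Vk hε hε50 hVk x hx c
  rw [recordQtC_ofReal F k K Vk x c hsmall]
  refine mlog_coe_mem_lieSU_of_norm_le _ ?_
  -- the window at `z = ↑x`
  have hz : ‖(fun j => (x j : ℂ))‖ < 1 / (10 ^ 8 * (F.P K).d * (F.P K).L) := (norm_ofReal_pi_le x).trans_lt hx
  have hsum := phi_add_lam_le_of_norm_le (F.P K).hd (F.P K).hL.2.le (norm_nonneg (fun j => (x j : ℂ))) hz.le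
  have hW := window_fiftieth_of_oneStep F k K hk Vk (fun j => (x j : ℂ)) (norm_pertC_mul_star_sub_one_le F k K Vk _) le_rfl le_rfl hε hsum hε50 c (hVk c)
  rw [pertC_ofReal, ← coe_avgFun_eq_avgMh (pert F k K Vk x) c hsmall, ← coe_inv_SU, ← Submonoid.coe_mul] at hW
  exact hW.trans (by norm_num)

/-- ★ **`C̃_ℂ(Vk)(↑x)(c) ∈ 𝔰𝔲(2)` FOR REAL `‖x‖ < R`** (`C̃_ℂ = Q̃_ℂ − LQ̃_ℂ`; ✓`recordLQtC_ofReal`, ✓`recordLQt_mem_lieSU_of_small`). [cite: Balaban1987RG1, (1.5) p.261, p.267] -/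
theorem recordCtC_ofReal_mem_lieSU (k K : ℕ) (hk : k + 1 ≤ (F.P K).m + (F.P K).K) (Vk : GaugeField (F.P K) k (SU 2)) {ε : ℝ}
    (hε : ∀ (c : PBond (F.P K) (k + 1)) (i : Idx (F.P K)), ‖loopM (coeField Vk) c i - 1‖ ≤ ε) (hε50 : ε ≤ 1 / 50)
    (hVk : ∀ c, Small expMeanLogSU Vk c) (x : FluctIdx F k K → ℝ) (hx : ‖x‖ < 1 / (10 ^ 8 * (F.P K).d * (F.P K).L)) (c : PBond (F.P K) (k + 1)) :
    recordCtC F k K Vk (fun i => (x i : ℂ)) c ∈ lieSU (Fin 2) := by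
  show recordQtC F k K Vk (fun i => (x i : ℂ)) c - recordLQtC F k K Vk (fun i => (x i : ℂ)) c ∈ lieSU (Fin 2)
  rw [recordLQtC_ofReal F k K hk Vk hε hε50 hVk x]
  exact Submodule.sub_mem _ (recordQtC_ofReal_mem_lieSU F k K hk Vk hε hε50 hVk x hx c) (recordLQt_mem_lieSU_of_small F k K Vk hVk x c)

/-! ## §2  Real coordinates inside complex ones -/

/-- `‖(x_i : ℂ)_i‖ = ‖x‖` (sup norms). [folklore] -/
theorem norm_ofReal_pi_eq {ι : Type*} [Fintype ι] (x : ι → ℝ) : ‖(fun i => (x i : ℂ))‖ = ‖x‖ := by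
  refine le_antisymm (norm_ofReal_pi_le x) ((pi_norm_le_iff_of_nonneg (norm_nonneg _)).2 fun i => ?_)
  have h := norm_le_pi_norm (fun j => (x j : ℂ)) i
  rwa [Complex.norm_real] at h

/-- On an 𝔰𝔲(2)-valued coarse field `X`: `↑y − h_ℂ X = ↑(y − h X)` (◆ R-k bridge ✓`hopLinGraphC_of_mem_lieSU`). [cite: Balaban1987RG1, p.267 («(hB)(b₀(c)) = h(c)B(c)»)] -/
theorem ofReal_pi_sub_hopLinGraphC_of_mem_lieSU (k K : ℕ) (Vk : GaugeField (F.P K) k (SU 2)) (y : FluctIdx F k K → ℝ)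
    (X : PBond (F.P K) (k + 1) → MatA 2) (hX : ∀ c, X c ∈ lieSU (Fin 2)) :
    (fun i => (y i : ℂ)) - hopLinGraphC F k K Vk X = fun i => ((y - hopLinGraph F k K Vk X) i : ℂ) := by
  rw [hopLinGraphC_of_mem_lieSU F k K Vk X hX]
  funext i
  simp [Pi.sub_apply, Complex.ofReal_sub]

/-! ## §3  `D̃` of a real coordinate vector is 𝔰𝔲(2)-valued; `h_ℂ D̃(↑y)` is real -/

section Letters

variable {F}
variable {k K : ℕ} (hk : k + 1 ≤ (F.P K).m + (F.P K).K) (Vk : GaugeField (F.P K) k (SU 2)) {ε : ℝ}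
  (hε : ∀ (c : PBond (F.P K) (k + 1)) (i : Idx (F.P K)), ‖loopM (coeField Vk) c i - 1‖ ≤ ε) (hε50 : ε ≤ 1 / 50)
  (hVk : ∀ c, Small expMeanLogSU Vk c) {b ρ : ℝ} (hb : 0 ≤ b) (hHop : ∀ X, ‖hopLinGraphC F k K Vk X‖ ≤ b * ‖X‖)
  (hq : 9 * (2 * 1 / (1 / (10 ^ 8 * (F.P K).d * (F.P K).L)) ^ 2) * b * ρ < 1) (hρ : 3 * ρ ≤ 1 / (10 ^ 8 * (F.P K).d * (F.P K).L))

include hk hε hε50 hVk hb hHop hq hρ in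
/-- ★★★ **`D̃` OF A REAL COORDINATE VECTOR IS 𝔰𝔲(2)-VALUED**: for real `y` with `‖↑y‖ < ρ` and every coarse bond `c`, `recordDt Vk ρ ↑y c ∈ 𝔰𝔲(2)` — the set `S` of 𝔰𝔲(2)-valued coarse fields is
closed, contains `0`, and is stable under `X ↦ C̃_ℂ(↑y − h_ℂ X)` on the closed ball `4C₂ρ²` (there `↑y − h_ℂ X = ↑(y − hX)` is REAL of norm `< 2ρ ≤ R`, §1–§2), so the unique fixed point lies in
`S` (lit ✓`B12Lineariz267.Dt_mem_of_mapsTo`). [cite: Balaban1987RG1, p.267 («𝐠-valued function D̃»); Balaban1985Variational, (96)–(98) p.292] -/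
theorem recordDt_ofReal_mem_lieSU (y : FluctIdx F k K → ℝ) (hy : ‖(fun i => (y i : ℂ))‖ < ρ) (c : PBond (F.P K) (k + 1)) :
    recordDt F k K Vk ρ (fun i => (y i : ℂ)) c ∈ lieSU (Fin 2) := by
  have hρ0 : 0 < ρ := (norm_nonneg _).trans_lt hy
  have hd : (1 : ℝ) ≤ (F.P K).d := by exact_mod_cast (F.P K).hd
  have hL : (1 : ℝ) ≤ (F.P K).L := by exact_mod_cast (F.P K).hL.2.le
  have hC₂ : (0 : ℝ) ≤ 2 * 1 / (1 / (10 ^ 8 * (F.P K).d * (F.P K).L)) ^ 2 := by positivity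
  set S : Set (PBond (F.P K) (k + 1) → MatA 2) := {X | ∀ c, X c ∈ lieSU (Fin 2)} with hSdef
  have hS : IsClosed S := by
    have hrepr : S = ⋂ c : PBond (F.P K) (k + 1), (fun X : PBond (F.P K) (k + 1) → MatA 2 => X c) ⁻¹' ((lieSU (Fin 2) : Submodule ℝ (MatA 2)) : Set (MatA 2)) := by
      ext X; simp [hSdef]
    rw [hrepr]
    exact isClosed_iInter fun c => (Submodule.closed_of_finiteDimensional _).preimage (continuous_apply c)
  have h0S : (0 : PBond (F.P K) (k + 1) → MatA 2) ∈ S := fun c => Submodule.zero_mem _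
  have hmaps : ∀ X ∈ closedBall (0 : PBond (F.P K) (k + 1) → MatA 2) (4 * (2 * 1 / (1 / (10 ^ 8 * (F.P K).d * (F.P K).L)) ^ 2) * ρ ^ 2), X ∈ S →
      recordCtC F k K Vk ((fun i => (y i : ℂ)) - hopLinGraphC F k K Vk X) ∈ S := by
    intro X hXball hXS c'
    rw [ofReal_pi_sub_hopLinGraphC_of_mem_lieSU F k K Vk y X hXS]
    refine recordCtC_ofReal_mem_lieSU F k K hk Vk hε hε50 hVk _ ?_ c'
    -- the real argument has norm `< 2ρ ≤ R`
    have hK0 : 0 ≤ 9 * (2 * 1 / (1 / (10 ^ 8 * (F.P K).d * (F.P K).L)) ^ 2) * b * ρ := by positivity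
    have hR2 : 4 * (2 * 1 / (1 / (10 ^ 8 * (F.P K).d * (F.P K).L)) ^ 2) * b * ρ ≤ 1 := by nlinarith
    have hhX : ‖hopLinGraphC F k K Vk X‖ ≤ ρ := B13Contraction113.norm_Hop_le hb hρ0.le hHop hR2 hXball
    have hnormC : ‖(fun i => (y i : ℂ)) - hopLinGraphC F k K Vk X‖ < 2 * ρ := by
      calc ‖(fun i => (y i : ℂ)) - hopLinGraphC F k K Vk X‖ ≤ ‖(fun i => (y i : ℂ))‖ + ‖hopLinGraphC F k K Vk X‖ := norm_sub_le _ _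
        _ < ρ + ρ := add_lt_add_of_lt_of_le hy hhX
        _ = 2 * ρ := by ring
    rw [ofReal_pi_sub_hopLinGraphC_of_mem_lieSU F k K Vk y X hXS, norm_ofReal_pi_eq] at hnormC
    linarith
  exact B12Lineariz267.Dt_mem_of_mapsTo (Dt := recordDt F k K Vk ρ) (quadAnalytic_recordCtC F k K hk Vk hε hε50 hVk) hC₂ hb hHop hq hρ
    (fun _ hB => (recordDt_spec F k K hk Vk hε hε50 hVk hb hHop hq hρ hB).1) (fun _ hB => (recordDt_spec F k K hk Vk hε hε50 hVk hb hHop hq hρ hB).2)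
    hy hS h0S hmaps c

include hk hε hε50 hVk hb hHop hq hρ in
/-- ★★ **`h_ℂ D̃(↑y)` IS REAL**: `hopLinGraphC Vk (recordDt Vk ρ ↑y) = ↑(hopLinGraph Vk (recordDt Vk ρ ↑y))` for `‖↑y‖ < ρ`. [cite: Balaban1987RG1, p.267] -/
theorem hopLinGraphC_recordDt_ofReal (y : FluctIdx F k K → ℝ) (hy : ‖(fun i => (y i : ℂ))‖ < ρ) :
    hopLinGraphC F k K Vk (recordDt F k K Vk ρ (fun i => (y i : ℂ))) =
      fun i => ((hopLinGraph F k K Vk (recordDt F k K Vk ρ (fun i => (y i : ℂ))) i : ℝ) : ℂ) :=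
  hopLinGraphC_of_mem_lieSU F k K Vk _ (recordDt_ofReal_mem_lieSU hk Vk hε hε50 hVk hb hHop hq hρ y hy)

include hk hε hε50 hVk hb hHop hq hρ in
/-- `Φ(↑y) = ↑(y − h D̃(↑y))`: the complex translation at a real point is a REAL coordinate vector. [cite: Balaban1987RG1, p.267–268] -/
theorem recordPhi_recordDt_ofReal (y : FluctIdx F k K → ℝ) (hy : ‖(fun i => (y i : ℂ))‖ < ρ) :
    (fun i => (y i : ℂ)) - hopLinGraphC F k K Vk (recordDt F k K Vk ρ (fun i => (y i : ℂ))) =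
      fun i => ((y - hopLinGraph F k K Vk (recordDt F k K Vk ρ (fun i => (y i : ℂ)))) i : ℂ) :=
  ofReal_pi_sub_hopLinGraphC_of_mem_lieSU F k K Vk y _ (recordDt_ofReal_mem_lieSU hk Vk hε hε50 hVk hb hHop hq hρ y hy)

/-! ## §4  At ★★ DEF-1's names: `recordDtCorrOf`, `recordReparamOf` at the `recordDt` family -/

include hk hε hε50 hVk hb hHop hq hρ in
/-- ★★ **DEF-1's `recordDtCorrOf` AT THE `recordDt` FAMILY IS THE REAL CORRECTION, `Re`-EXACT**: `recordDtCorrOf F k (fun Vk => recordDt F k K Vk ρ) Vk y = hopLinGraph Vk (recordDt Vk ρ ↑y)` for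
`‖↑y‖ < ρ` (convention (c2) of ✓`…K0RecordFormatNamesFluctInt`: «real part = exact where `D̃` maps real points to 𝔰𝔲(2) — a bridge theorem of the consumer»; THIS is that bridge).
[cite: Balaban1987RG1, p.267 («B′ = B − hD̃(B)»)] -/
theorem recordDtCorrOf_recordDt (y : FluctIdx F k K → ℝ) (hy : ‖(fun i => (y i : ℂ))‖ < ρ) :
    recordDtCorrOf F k (fun Vk => recordDt F k K Vk ρ) Vk y = hopLinGraph F k K Vk (recordDt F k K Vk ρ (fun i => (y i : ℂ))) := by
  funext i
  show (hopLinGraphC F k K Vk (recordDt F k K Vk ρ fun j => ((y j : ℝ) : ℂ)) i).re = _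
  rw [hopLinGraphC_recordDt_ofReal hk Vk hε hε50 hVk hb hHop hq hρ y hy, Complex.ofReal_re]

include hk hε hε50 hVk hb hHop hq hρ in
/-- ★★ **DEF-1's RE-PARAMETRISED VARIABLE IS PRINT's OLD VARIABLE ON THE REAL SLICE**: `↑(recordReparamOf F k (fun Vk => recordDt F k K Vk ρ) Vk g x) = Φ(↑(g•x)) = ↑(g•x) − h_ℂ D̃(↑(g•x))` for
`‖↑(g•x)‖ < ρ` — «B′ = B − hD̃(B)» at `B = g_k x`. [cite: Balaban1987RG1, p.267–268, (2.12) p.268] -/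
theorem ofReal_recordReparamOf_recordDt (g : ℝ) (x : FluctIdx F k K → ℝ) (hgx : ‖(fun i => ((g • x) i : ℂ))‖ < ρ) :
    (fun i => ((recordReparamOf F k (fun Vk => recordDt F k K Vk ρ) Vk g x) i : ℂ)) =
      (fun i => (((g • x) i : ℝ) : ℂ)) - hopLinGraphC F k K Vk (recordDt F k K Vk ρ (fun i => (((g • x) i : ℝ) : ℂ))) := by
  rw [recordPhi_recordDt_ofReal hk Vk hε hε50 hVk hb hHop hq hρ (g • x) hgx]
  unfold recordReparamOf
  rw [recordDtCorrOf_recordDt hk Vk hε hε50 hVk hb hHop hq hρ (g • x) hgx]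

include hk hε hε50 hVk hb hHop hq hρ in
/-- `‖↑Y_g(x)‖ < 2ρ` (`≤ R`): the translated real point stays in `Ψ`'s ball. [cite: Balaban1987RG1, p.267–268] -/
theorem norm_ofReal_recordReparamOf_recordDt_lt (g : ℝ) (x : FluctIdx F k K → ℝ) (hgx : ‖(fun i => ((g • x) i : ℂ))‖ < ρ) :
    ‖(fun i => ((recordReparamOf F k (fun Vk => recordDt F k K Vk ρ) Vk g x) i : ℂ))‖ < 2 * ρ := by
  rw [ofReal_recordReparamOf_recordDt hk Vk hε hε50 hVk hb hHop hq hρ g x hgx]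
  exact norm_recordPhi_recordDt_lt hk Vk hε hε50 hVk hb hHop hq hρ hgx

end Letters

end Summit.QuantumFields.YangMills.Theorems.BalabanUVNodesPortS1

end
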